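import Summits.CriticalPhenomena.Ising3DConformalLimit.Theorems.EnergyNotSigmaSquaredGapForcesFarMergingRootFiniteEnergy
import Literature.Probability.LatticeModels.ThermodynamicLimit

/-! # Finite energy across a box hole of `ℤ^d`
(line `screening-form-lemma-a1` of crux `GapForcesFarMerging`, item stmt-CriticalPhenomena-4468;
helper file of stub `stub_rootOpacity`, ROOT FINITE ENERGY, lattice part)

For `d ≥ 2`, `β > 0` and a fixed hole `Λ_r = box d r`: depleting all nearest-neighbour bonds meeting
`Λ_r` changes the free two-point function of the box `Λ_n` (`n ≥ r+1`) between a site of the shell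
`Λ_{r+1} ∖ Λ_r` and ANY site off the hole by a factor bounded uniformly in `n` and in the far site:
`⟨σ_yσ_v⟩^∅_{Λ_n} ≤ C(r,β,d) ⟨σ_yσ_v⟩^∅_{Λ_n ∖ Λ_r}` (`finiteEnergy_boxHole`). Proof: the general
comparison `isingCorr_free_le_of_deleted` (deleted edges = the bonds meeting `Λ_r`, boundaries `∂S`
inside `Λ_{r+1}`); a boundary set through a site of `Λ_r` gives a vanishing correlation (isolated spin),
and an even boundary set inside the shell has `⟨σ_{∂S}⟩_{Λ_n∖Λ_r} ≥ ⟨σ_{∂S}⟩_{shell} ≥ c(r,β,d) > 0`: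
the shell is chained to its corner `(r+1,…,r+1)` by axis moves (`isingCorr_shell_corner_pos`), so all
its even correlations are positive (GKS II). References: Friedli–Velenik 2017, Thm. 3.20, Exercise 3.12,
Exercise 3.31; Burton–Keane 1989 (finite energy). -/

noncomputable section

namespace Summit.CriticalPhenomena.Ising3DConformalLimit.EnergyNotSigmaSquaredGapForcesFarMerging

open scoped symmDiff
open MeasureTheory Finset
open Literature.Probability.LatticeModels

variable {d : ℕ}

/-! ### Axis moves -/

/-- Consecutive sites along an axis are adjacent in `ℤ^d`. [folklore] -/
theorem zdGraph_adj_update_succ (x : Site d) (j : Fin d) (v : ℤ) :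
    (zdGraph d).Adj (Function.update x j v) (Function.update x j (v + 1)) := by
  rw [zdGraph_adj_iff]
  refine ⟨j, Or.inl ?_⟩
  funext i
  by_cases h : i = j
  · subst h; simp
  · simp [h]

/-- **Positivity along an axis move inside a volume**: if the sites `update x j (v+t)`, `t ≤ k`, lie in
`Λ'`, then `⟨σ_{update x j v} σ_{update x j (v+k)}⟩^∅_{Λ';β,0} > 0` (`β > 0`). [cite: FriedliVelenik2017, §3.8.1, p. 141] -/
theorem isingCorr_axisMove_pos {Λ' : Finset (Site d)} {β : ℝ} (hβ : 0 < β) (x : Site d) (j : Fin d)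
    (v : ℤ) (k : ℕ) (hmem : ∀ t : ℕ, t ≤ k → Function.update x j (v + t) ∈ Λ') :
    0 < isingCorr (zdGraph d) Λ' β 0 .free
      ({Function.update x j v} ∆ {Function.update x j (v + k)}) := by
  have h := isingCorr_pos_of_adj_chain (zdGraph d) hβ (fun t : ℕ => Function.update x j (v + t)) k
    (fun t ht => hmem t ht) (fun t _ => by
      have h := zdGraph_adj_update_succ x j (v + t)
      push_cast
      rwa [add_assoc] at h)
  simpa using h

/-! ### The shell `Λ_{r+1} ∖ Λ_r` and its corner -/

/-- Membership in the shell `Λ_{r+1} ∖ Λ_r`. [folklore] -/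
theorem mem_shell_iff (r : ℕ) (x : Site d) :
    x ∈ box d (r + 1) \ box d r ↔
      (∀ i, -((r : ℤ) + 1) ≤ x i ∧ x i ≤ (r : ℤ) + 1) ∧ ∃ i, (r : ℤ) < x i ∨ x i < -(r : ℤ) := by
  rw [Finset.mem_sdiff, mem_box, mem_box]
  push_cast
  refine and_congr Iff.rfl ?_
  rw [not_forall]
  refine exists_congr fun i => ?_
  rw [not_and_or, not_le, not_le, or_comm]

/-- An axis move of a coordinate `j` keeps a site in the shell as long as another coordinate `i ≠ j`
sticks out of `Λ_r` and the new value stays in `[-(r+1), r+1]`. [folklore] -/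
theorem update_mem_shell {r : ℕ} {x : Site d} (hx : ∀ i, -((r : ℤ) + 1) ≤ x i ∧ x i ≤ (r : ℤ) + 1)
    (j : Fin d) {t : ℤ} (ht : -((r : ℤ) + 1) ≤ t ∧ t ≤ (r : ℤ) + 1) {i : Fin d} (hij : i ≠ j)
    (hi : (r : ℤ) < x i ∨ x i < -(r : ℤ)) : Function.update x j t ∈ box d (r + 1) \ box d r := by
  rw [mem_shell_iff]
  refine ⟨fun i' => ?_, ⟨i, by rwa [Function.update_of_ne hij]⟩⟩
  by_cases h : i' = j
  · subst h; rwa [Function.update_self]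
  · rw [Function.update_of_ne h]; exact hx i'

/-- Raising the coordinates of `J ∌ i` to `r+1`, keeping a coordinate `i` that sticks out: the chain stays
in the shell, so `⟨σ_a σ_{a^J}⟩_{shell} > 0`. [folklore] -/
theorem isingCorr_shell_raise_pos {β : ℝ} (hβ : 0 < β) (r : ℕ) {a : Site d}
    (ha : ∀ i, -((r : ℤ) + 1) ≤ a i ∧ a i ≤ (r : ℤ) + 1) {i : Fin d} (hi : (r : ℤ) < a i ∨ a i < -(r : ℤ))
    (J : Finset (Fin d)) (hiJ : i ∉ J) :
    0 < isingCorr (zdGraph d) (box d (r + 1) \ box d r) β 0 .free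
      ({a} ∆ {fun j => if j ∈ J then (r : ℤ) + 1 else a j}) := by
  induction J using Finset.induction_on with
  | empty =>
    have : (fun j => if j ∈ (∅ : Finset (Fin d)) then (r : ℤ) + 1 else a j) = a := funext fun j => by simp
    rw [this, symmDiff_self, Finset.bot_eq_empty, isingCorr_empty]; exact one_pos
  | insert j J hjJ ih =>
    have hij : i ≠ j := fun h => hiJ (h ▸ mem_insert_self j J)
    have hiJ' : i ∉ J := fun h => hiJ (mem_insert_of_mem h)
    have ih' := ih hiJ'
    set p : Site d := fun j' => if j' ∈ J then (r : ℤ) + 1 else a j' with hp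
    have hpmem : ∀ i', -((r : ℤ) + 1) ≤ p i' ∧ p i' ≤ (r : ℤ) + 1 := fun i' => by
      simp only [hp]; split_ifs
      · constructor <;> linarith
      · exact ha i'
    have hpi : (r : ℤ) < p i ∨ p i < -(r : ℤ) := by simp only [hp, if_neg hiJ']; exact hi
    have hpj : p j = a j := by simp only [hp, if_neg hjJ]
    -- the new point is an axis move of `p` in the coordinate `j`
    have hnew : (fun j' => if j' ∈ insert j J then (r : ℤ) + 1 else a j') =
        Function.update p j (a j + ((r : ℤ) + 1 - a j).toNat) := by
      rw [Int.toNat_of_nonneg (by linarith [(ha j).2]), add_sub_cancel]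
      funext j'
      by_cases h : j' = j
      · subst h; simp
      · simp [hp, h]
    have hmove := isingCorr_axisMove_pos (Λ' := box d (r + 1) \ box d r) hβ p j (a j)
      ((r : ℤ) + 1 - a j).toNat (fun t ht => by
        refine update_mem_shell hpmem j ⟨by linarith [(ha j).1], ?_⟩ hij hpi
        have : (t : ℤ) ≤ ((r : ℤ) + 1 - a j).toNat := by exact_mod_cast ht
        rw [Int.toNat_of_nonneg (by linarith [(ha j).2])] at this
        linarith)
    rw [← hnew, ← hpj, Function.update_eq_self] at hmove
    -- membership of the three points in the shell
    have hamem : a ∈ box d (r + 1) \ box d r := (mem_shell_iff r a).2 ⟨ha, i, hi⟩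
    have hpmem' : p ∈ box d (r + 1) \ box d r := (mem_shell_iff r p).2 ⟨hpmem, i, hpi⟩
    have hqmem : (fun j' => if j' ∈ insert j J then (r : ℤ) + 1 else a j') ∈ box d (r + 1) \ box d r := by
      rw [hnew]
      exact update_mem_shell hpmem j ⟨by linarith [(ha j).1, Int.self_le_toNat ((r : ℤ) + 1 - a j)],
        by rw [Int.toNat_of_nonneg (by linarith [(ha j).2])]; linarith⟩ hij hpi
    exact lt_of_lt_of_le (mul_pos ih' hmove) (isingCorr_pair_chain (zdGraph d) hamem hpmem' hqmem hβ.le)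

/-- **The shell is chained to its corner**: for `d ≥ 2`, `β > 0` and `a ∈ Λ_{r+1} ∖ Λ_r`,
`⟨σ_a σ_{(r+1,…,r+1)}⟩^∅_{Λ_{r+1}∖Λ_r;β,0} > 0` (raise the coordinates other than a sticking-out one to
`r+1`, then that one). [folklore] -/
theorem isingCorr_shell_corner_pos (hd : 2 ≤ d) {β : ℝ} (hβ : 0 < β) (r : ℕ) {a : Site d}
    (ha : a ∈ box d (r + 1) \ box d r) :
    0 < isingCorr (zdGraph d) (box d (r + 1) \ box d r) β 0 .free ({a} ∆ {fun _ => (r : ℤ) + 1}) := by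
  obtain ⟨ha1, i, hi⟩ := (mem_shell_iff r a).1 ha
  have hraise := isingCorr_shell_raise_pos hβ r ha1 hi (univ.erase i) (Finset.notMem_erase i univ)
  set p : Site d := fun j => if j ∈ univ.erase i then (r : ℤ) + 1 else a j with hp
  have hpj : ∀ j, j ≠ i → p j = (r : ℤ) + 1 := fun j hj => by
    simp only [hp, if_pos (Finset.mem_erase.2 ⟨hj, mem_univ j⟩)]
  have hpi : p i = a i := by simp only [hp, if_neg (Finset.notMem_erase i univ)]
  have hpmem : ∀ i', -((r : ℤ) + 1) ≤ p i' ∧ p i' ≤ (r : ℤ) + 1 := fun i' => by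
    by_cases h : i' = i
    · rw [h, hpi]; exact ha1 i
    · rw [hpj i' h]; constructor <;> linarith
  -- another coordinate `j₀ ≠ i`, which equals `r+1` along the last move
  obtain ⟨j₀, hj₀⟩ : ∃ j₀ : Fin d, j₀ ≠ i := by
    by_cases h0 : (⟨0, by omega⟩ : Fin d) = i
    · exact ⟨⟨1, by omega⟩, fun h => by rw [← h0] at h; exact absurd (congrArg Fin.val h) (by simp)⟩
    · exact ⟨⟨0, by omega⟩, h0⟩
  have hj₀out : (r : ℤ) < p j₀ ∨ p j₀ < -(r : ℤ) := Or.inl (by rw [hpj j₀ hj₀]; linarith)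
  have hcorner : (fun _ : Fin d => (r : ℤ) + 1) = Function.update p i (a i + ((r : ℤ) + 1 - a i).toNat) := by
    rw [Int.toNat_of_nonneg (by linarith [(ha1 i).2]), add_sub_cancel]
    funext j'
    by_cases h : j' = i
    · subst h; simp
    · rw [Function.update_of_ne h, hpj j' h]
  have hmove := isingCorr_axisMove_pos (Λ' := box d (r + 1) \ box d r) hβ p i (a i)
    ((r : ℤ) + 1 - a i).toNat (fun t ht => by
      refine update_mem_shell hpmem i ⟨by linarith [(ha1 i).1], ?_⟩ hj₀ hj₀out
      have : (t : ℤ) ≤ ((r : ℤ) + 1 - a i).toNat := by exact_mod_cast ht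
      rw [Int.toNat_of_nonneg (by linarith [(ha1 i).2])] at this
      linarith)
  rw [← hcorner, ← hpi, Function.update_eq_self] at hmove
  have hpmem' : p ∈ box d (r + 1) \ box d r := (mem_shell_iff r p).2 ⟨hpmem, j₀, hj₀out⟩
  have hcmem : (fun _ : Fin d => (r : ℤ) + 1) ∈ box d (r + 1) \ box d r :=
    (mem_shell_iff r _).2 ⟨fun _ => ⟨by linarith, le_rfl⟩, i, Or.inl (by linarith)⟩
  exact lt_of_lt_of_le (mul_pos hraise hmove) (isingCorr_pair_chain (zdGraph d) ha hpmem' hcmem hβ.le)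

/-- **Even correlations of the shell are bounded below**: for `d ≥ 2`, `β > 0` there is `c(r,β,d) > 0` with
`⟨σ_B⟩^∅_{Λ_{r+1}∖Λ_r;β,0} ≥ c` for every `B ⊆ Λ_{r+1} ∖ Λ_r` of even cardinality. [folklore] -/
theorem exists_shell_even_lower (hd : 2 ≤ d) {β : ℝ} (hβ : 0 < β) (r : ℕ) :
    ∃ c : ℝ, 0 < c ∧ ∀ B ⊆ box d (r + 1) \ box d r, Even #B →
      c ≤ isingCorr (zdGraph d) (box d (r + 1) \ box d r) β 0 .free B := by
  classical
  have hpair : ∀ a ∈ box d (r + 1) \ box d r, ∀ b ∈ box d (r + 1) \ box d r,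
      0 < isingCorr (zdGraph d) (box d (r + 1) \ box d r) β 0 .free ({a} ∆ {b}) := by
    intro a ha b hb
    have hcmem : (fun _ : Fin d => (r : ℤ) + 1) ∈ box d (r + 1) \ box d r :=
      (mem_shell_iff r _).2 ⟨fun _ => ⟨by linarith, le_rfl⟩, ⟨0, by omega⟩, Or.inl (by linarith)⟩
    have h1 := isingCorr_shell_corner_pos hd hβ r ha
    have h2 := isingCorr_shell_corner_pos hd hβ r hb
    rw [symmDiff_comm] at h2
    exact lt_of_lt_of_le (mul_pos h1 h2) (isingCorr_pair_chain (zdGraph d) ha hcmem hb hβ.le)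
  have hpos := isingCorr_pos_of_even (zdGraph d) (subset_refl (box d (r + 1) \ box d r)) hβ.le hpair
  set s := (box d (r + 1) \ box d r).powerset.filter fun B => Even #B with hs
  have hne : s.Nonempty := ⟨∅, by simp [hs]⟩
  obtain ⟨B₀, hB₀, hmin⟩ := s.exists_min_image
    (fun B => isingCorr (zdGraph d) (box d (r + 1) \ box d r) β 0 .free B) hne
  rw [hs, mem_filter, mem_powerset] at hB₀
  exact ⟨_, hpos B₀ hB₀.1 hB₀.2, fun B hB hev => hmin B (by rw [hs, mem_filter, mem_powerset]; exact ⟨hB, hev⟩)⟩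

/-! ### Finite energy across the hole `Λ_r` -/

/-- Correlations of the graph with the bonds meeting a hole `T` deleted are the free correlations of the
depleted region: `⟨σ_B⟩_{Λ; ℤ^d ∖ T} = ⟨σ_B⟩^∅_{Λ ∖ T}` for `B ⊆ Λ ∖ T`. [cite: FriedliVelenik2017, §3.1] -/
theorem isingCorr_holeGraph_eq {G₁ : SimpleGraph (Site d)} [G₁.LocallyFinite] {T : Finset (Site d)}
    (hG₁ : ∀ x y, G₁.Adj x y ↔ (zdGraph d).Adj x y ∧ x ∉ T ∧ y ∉ T) {Λ : Finset (Site d)}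
    {B : Finset (Site d)} (hB : B ⊆ Λ \ T) (β h : ℝ) :
    isingCorr G₁ Λ β h .free B = isingCorr (zdGraph d) (Λ \ T) β h .free B := by
  have hE : edgesIn G₁ Λ ⊆ edgesIn G₁ (Λ \ T) := fun e he => by
    rw [mem_edgesIn_iff] at he ⊢
    refine ⟨he.1, ?_⟩
    obtain ⟨he1, he2⟩ := he
    induction e using Sym2.ind with
    | _ u v =>
      have huv := (hG₁ u v).1 ((SimpleGraph.mem_edgeSet G₁).1 he1)
      intro x hx
      rw [Finset.mem_sdiff]
      rcases Sym2.mem_iff.1 hx with rfl | rfl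
      · exact ⟨he2 _ hx, huv.2.1⟩
      · exact ⟨he2 _ hx, huv.2.2⟩
  have hE' : edgesIn G₁ (Λ \ T) = edgesIn (zdGraph d) (Λ \ T) := by
    ext e
    rw [mem_edgesIn_iff, mem_edgesIn_iff]
    induction e using Sym2.ind with
    | _ u v =>
      rw [SimpleGraph.mem_edgeSet, SimpleGraph.mem_edgeSet, hG₁]
      constructor
      · rintro ⟨⟨h, -, -⟩, h2⟩; exact ⟨h, h2⟩
      · rintro ⟨h, h2⟩
        exact ⟨⟨h, (Finset.mem_sdiff.1 (h2 u (Sym2.mem_mk_left u v))).2,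
          (Finset.mem_sdiff.1 (h2 v (Sym2.mem_mk_right u v))).2⟩, h2⟩
  rw [isingCorr_free_eq_of_edgesIn_subset G₁ Finset.sdiff_subset hE β h hB]
  simp only [isingCorr, isingExpect, isingMeasure_free_congr_edgesIn hE']

/-- **FINITE ENERGY ACROSS A BOX HOLE.** For `d ≥ 2`, `β > 0` and `r`, there is `C = C(r,β,d)` such
that for all `n ≥ r+1`, every shell site `y ∈ Λ_{r+1} ∖ Λ_r` and every site `v ∈ Λ_n ∖ Λ_r`,
`⟨σ_{{y}∆{v}}⟩^∅_{Λ_n;β,0} ≤ C · ⟨σ_{{y}∆{v}}⟩^∅_{Λ_n ∖ Λ_r;β,0}` — depleting the bonds meeting the fixed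
hole `Λ_r` costs a bounded factor, uniformly in the volume and in the far site. [cite: FriedliVelenik2017, Exercise 3.31] -/
theorem finiteEnergy_boxHole (hd : 2 ≤ d) {β : ℝ} (hβ : 0 < β) (r : ℕ) :
    ∃ C : ℝ, 0 < C ∧ ∀ n : ℕ, r + 1 ≤ n → ∀ y ∈ box d (r + 1) \ box d r, ∀ v ∈ box d n \ box d r,
      isingCorr (zdGraph d) (box d n) β 0 .free ({y} ∆ {v}) ≤
        C * isingCorr (zdGraph d) (box d n \ box d r) β 0 .free ({y} ∆ {v}) := by
  classical
  obtain ⟨c, hc, hcB⟩ := exists_shell_even_lower hd hβ r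
  refine ⟨c⁻¹ * Real.exp (2 * β * #(edgesTouching (zdGraph d) (box d r))), by positivity,
    fun n hn y hy v hv => ?_⟩
  -- the graph with the bonds meeting `Λ_r` deleted
  let G₁ : SimpleGraph (Site d) :=
    { Adj := fun x y => (zdGraph d).Adj x y ∧ x ∉ box d r ∧ y ∉ box d r
      symm := ⟨fun x y hxy => ⟨hxy.1.symm, hxy.2.2, hxy.2.1⟩⟩
      loopless := ⟨fun x hx => (zdGraph d).irrefl hx.1⟩ }
  haveI : G₁.LocallyFinite := fun v =>
    Fintype.ofFinset (((zdGraph d).neighborFinset v).filter fun w => v ∉ box d r ∧ w ∉ box d r) fun w => by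
      simp [G₁, SimpleGraph.mem_neighborSet]
  have hG₁ : ∀ x y, G₁.Adj x y ↔ (zdGraph d).Adj x y ∧ x ∉ box d r ∧ y ∉ box d r := fun _ _ => Iff.rfl
  have hle : G₁ ≤ zdGraph d := fun x y hxy => hxy.1
  have hyn : y ∈ box d n \ box d r :=
    Finset.mem_sdiff.2 ⟨box_mono d hn (Finset.mem_sdiff.1 hy).1, (Finset.mem_sdiff.1 hy).2⟩
  have hAsub : ({y} ∆ {v} : Finset (Site d)) ⊆ box d n \ box d r := fun x hx => by
    rcases Finset.mem_symmDiff.1 hx with ⟨h, -⟩ | ⟨h, -⟩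
    · rw [Finset.mem_singleton.1 h]; exact hyn
    · rw [Finset.mem_singleton.1 h]; exact hv
  have hAn : ({y} ∆ {v} : Finset (Site d)) ⊆ box d n := hAsub.trans Finset.sdiff_subset
  -- the deleted edges meet `Λ_r`
  have hD : edgesIn (zdGraph d) (box d n) \ edgesIn G₁ (box d n) ⊆ edgesTouching (zdGraph d) (box d r) := by
    intro e he
    rw [Finset.mem_sdiff, mem_edgesIn_iff, mem_edgesIn_iff] at he
    obtain ⟨⟨he1, he2⟩, he3⟩ := he
    rw [mem_edgesTouching_iff]
    refine ⟨he1, ?_⟩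
    by_contra hno
    push Not at hno
    apply he3
    refine ⟨?_, he2⟩
    induction e using Sym2.ind with
    | _ u w =>
      rw [SimpleGraph.mem_edgeSet]
      exact ⟨(SimpleGraph.mem_edgeSet _).1 he1, fun h => hno u h (Sym2.mem_mk_left u w),
        fun h => hno w h (Sym2.mem_mk_right u w)⟩
  -- the hypothesis of the general comparison
  have hbound : ∀ S ⊆ edgesIn (zdGraph d) (box d n) \ edgesIn G₁ (box d n),
      isingCorr G₁ (box d n) β 0 .free (({y} ∆ {v}) ∆ S.fold (fun s t : Finset (Site d) => s ∆ t) ∅ Sym2.toFinset) ≤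
        c⁻¹ * isingCorr G₁ (box d n) β 0 .free ({y} ∆ {v}) := by
    intro S hS
    set B := S.fold (fun s t : Finset (Site d) => s ∆ t) ∅ Sym2.toFinset with hBdef
    have hA0 : 0 ≤ isingCorr G₁ (box d n) β 0 .free ({y} ∆ {v}) :=
      GKSInequalities.gks_one_holds G₁ hβ.le le_rfl (Or.inl rfl) hAn
    -- vertices of `B` lie in `Λ_{r+1} ∩ Λ_n`
    have hBsub : ∀ q ∈ B, q ∈ box d n ∧ q ∈ box d (r + 1) := by
      intro q hq
      obtain ⟨e, he, hqe⟩ := Finset.mem_biUnion.1 (fold_symmDiff_toFinset_subset S hq)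
      have he' := hS he
      obtain ⟨he1, x, hx, hxe⟩ := mem_edgesTouching_iff.1 (hD he')
      rw [Finset.mem_sdiff, mem_edgesIn_iff] at he'
      have hqe' : q ∈ e := Sym2.mem_toFinset.1 hqe
      refine ⟨he'.1.2 q hqe', ?_⟩
      -- `q` is `x ∈ Λ_r` or a neighbour of it
      induction e using Sym2.ind with
      | _ u w =>
        have hadj := (SimpleGraph.mem_edgeSet _).1 he1
        have key : ∀ {a b : Site d}, (zdGraph d).Adj a b → a ∈ box d r → b ∈ box d (r + 1) := by
          intro a b hab ha
          rw [mem_box] at ha ⊢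
          obtain ⟨i, h | h⟩ := (zdGraph_adj_iff a b).1 hab
          · intro i'; rw [h]; by_cases hi : i' = i
            · subst hi; simp; constructor <;> linarith [(ha i').1, (ha i').2]
            · simp [hi]; constructor <;> linarith [(ha i').1, (ha i').2]
          · intro i'
            have h' : b i' = a i' - (Pi.single i (1 : ℤ) : Site d) i' := by rw [h]; simp
            rw [h']; by_cases hi : i' = i
            · subst hi; simp; constructor <;> linarith [(ha i').1, (ha i').2]
            · simp [hi]; constructor <;> linarith [(ha i').1, (ha i').2]
        rcases Sym2.mem_iff.1 hqe' with rfl | rfl <;> rcases Sym2.mem_iff.1 hxe with rfl | rfl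
        · exact box_mono d (Nat.le_succ r) hx
        · exact key hadj.symm hx
        · exact key hadj hx
        · exact box_mono d (Nat.le_succ r) hx
    by_cases hq : ∃ q ∈ B, q ∈ box d r
    · -- an isolated spin of `Λ_r`: the correlation vanishes
      obtain ⟨q, hqB, hqr⟩ := hq
      have hqA : q ∈ ({y} ∆ {v}) ∆ B := by
        rw [Finset.mem_symmDiff]
        refine Or.inr ⟨hqB, fun h => ?_⟩
        exact (Finset.mem_sdiff.1 (hAsub h)).2 hqr
      rw [isingCorr_free_eq_zero_of_isolated G₁ (hBsub q hqB).1 hqA (fun e he hqe => ?_) β]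
      · exact mul_nonneg (inv_nonneg.2 hc.le) hA0
      · rw [mem_edgesIn_iff] at he
        induction e using Sym2.ind with
        | _ u w =>
          have h := (SimpleGraph.mem_edgeSet G₁).1 he.1
          rcases Sym2.mem_iff.1 hqe with rfl | rfl
          · exact h.2.1 hqr
          · exact h.2.2 hqr
    · -- `B` is an even subset of the shell: GKS II and the shell lower bound
      push Not at hq
      have hBshell : B ⊆ box d (r + 1) \ box d r := fun q hqB =>
        Finset.mem_sdiff.2 ⟨(hBsub q hqB).2, hq q hqB⟩
      have hBnr : B ⊆ box d n \ box d r := fun q hqB => Finset.mem_sdiff.2 ⟨(hBsub q hqB).1, hq q hqB⟩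
      have hBeven : Even #B := even_card_fold_symmDiff S fun e he =>
        SimpleGraph.not_isDiag_of_mem_edgeSet _ (mem_edgesIn_iff.1 (Finset.mem_sdiff.1 (hS he)).1).1
      have hBlow : c ≤ isingCorr G₁ (box d n) β 0 .free B := by
        rw [isingCorr_holeGraph_eq hG₁ hBnr]
        refine (hcB B hBshell hBeven).trans (isingCorr_free_le_of_subset (zdGraph d) hβ.le le_rfl hBshell ?_)
        exact Finset.sdiff_subset_sdiff (box_mono d hn) le_rfl
      have hgks := GKSInequalities.gks_two_holds G₁ hβ.le le_rfl (Or.inl rfl) (A := ({y} ∆ {v}) ∆ B) (B := B)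
        (fun x hx => by
          rcases Finset.mem_symmDiff.1 hx with ⟨h, -⟩ | ⟨h, -⟩
          · exact hAn h
          · exact (hBsub x h).1) (fun x hx => (hBsub x hx).1)
      rw [symmDiff_assoc ({y} ∆ {v}) B B, symmDiff_self, symmDiff_bot] at hgks
      rw [inv_mul_eq_div, le_div_iff₀ hc]
      calc isingCorr G₁ (box d n) β 0 .free (({y} ∆ {v}) ∆ B) * c
          ≤ isingCorr G₁ (box d n) β 0 .free (({y} ∆ {v}) ∆ B) * isingCorr G₁ (box d n) β 0 .free B :=
            mul_le_mul_of_nonneg_left hBlow (GKSInequalities.gks_one_holds G₁ hβ.le le_rfl (Or.inl rfl)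
              (fun x hx => by
                rcases Finset.mem_symmDiff.1 hx with ⟨h, -⟩ | ⟨h, -⟩
                · exact hAn h
                · exact (hBsub x h).1))
        _ ≤ isingCorr G₁ (box d n) β 0 .free ({y} ∆ {v}) := hgks
  have hmain := isingCorr_free_le_of_deleted hle hβ.le hAn hbound
  rw [isingCorr_holeGraph_eq hG₁ hAsub] at hmain
  refine hmain.trans (mul_le_mul_of_nonneg_right ?_ ?_)
  · exact mul_le_mul_of_nonneg_left (Real.exp_le_exp.2 (mul_le_mul_of_nonneg_left
      (by exact_mod_cast Finset.card_le_card hD) (by positivity))) (inv_nonneg.2 hc.le)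
  · exact GKSInequalities.gks_one_holds (zdGraph d) hβ.le le_rfl (Or.inl rfl) hAsub

/-- **Finite energy across a box hole of `ℤ³`** (registered form of `finiteEnergy_boxHole` at `d = 3`). [cite: FriedliVelenik2017, Exercise 3.31] -/
theorem finiteEnergy_boxHole_three : ∀ {β : ℝ}, 0 < β → ∀ r : ℕ, ∃ C : ℝ, 0 < C ∧ ∀ n : ℕ, r + 1 ≤ n → ∀ y ∈ box 3 (r + 1) \ box 3 r, ∀ v ∈ box 3 n \ box 3 r, isingCorr (zdGraph 3) (box 3 n) β 0 .free ({y} ∆ {v}) ≤ C * isingCorr (zdGraph 3) (box 3 n \ box 3 r) β 0 .free ({y} ∆ {v}) :=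
  fun hβ r => finiteEnergy_boxHole (d := 3) (by norm_num) hβ r

end Summit.CriticalPhenomena.Ising3DConformalLimit.EnergyNotSigmaSquaredGapForcesFarMerging

end
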